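import Literature.NumberTheory.EllipticCurves.SzpiroLocalDataProofs
import Literature.NumberTheory.EllipticCurves.Greenberg1999.TwoTorsionMuInvariant
import HarnessLib

/-!
# A rational point of order `2` forces `f₃ ≤ 2` (the conductor is tame at `3`)

Topic `Literature/NumberTheory/EllipticCurves`; namespace `Literature.NumberTheory.EllipticCurves`.
ONE named fact (statement-only, cited) and its proved corollary in the shape consumed by the
Birch–Swinnerton-Dyer cell's line `star` (`starAdmissibleHabitat_of_facts`, hypothesis `hOgg3`).

## The statement and its printed proof

Let `E/ℚ` be an elliptic curve with a rational point of order `2`, and let `K = ℚ₃` (residue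
characteristic `p = 3`). The wild part `δ(E/K)` of the exponent of the conductor is defined through
the `ℓ`-torsion for a prime `ℓ ≠ p` [Silverman1994, IV §10, definition preceding Thm 10.2]:
`δ(E/K) = Σ_{i ≥ 1} (g_i/g_0) · dim_{𝔽_ℓ} (E[ℓ]/E[ℓ]^{G_i})`, `G_i = G_i(L/K)` the higher
ramification groups of `L = K(E[ℓ])`, and `f(E/K) = ε(E/K) + δ(E/K)` with the tame part
`ε ∈ {0, 1, 2}` [Silverman1994, IV Thm 10.2]; `f` is independent of `ℓ` [Silverman1994, IV
Thm 10.2(c); Ogg, Serre–Tate §3]. For `p = 3` one may take `ℓ = 2`: this is exactly how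
[Silverman1994, IV §11, proof of Thm 11.1 for `p = 3` (pp. 366–367 of the PDF; book pp. 390–391)]
computes `δ(E/K) = Σ_{i≥1} g_i(L/K)/g_0(L/K) · dim_{𝔽₂}(E[2]/E[2]^{G_i(L/K)})` with
`L = K(E[2])` the splitting field of the `2`-division cubic, concluding "`L/K` is not wildly
ramified, so `δ(E/K) = 0`" whenever `[L : K]` is prime to `3`. A `K`-rational point of order `2`
is a `K`-rational root of the `2`-division cubic, so `[L : K] ≤ 2`, `L/K` is (at worst) tamely
ramified, `G_i(L/K) = 1` for `i ≥ 1`, hence `δ(E/ℚ₃) = 0` and `f₃ = ε₃ ≤ 2`.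

In the tree `WeierstrassCurve.conductorExponent` is Ogg's `ord_v(Δ_min) + 1 − m_v`
(`Literature/NumberTheory/DiophantineGeometry/Conductor.lean`), equal to `ε_v + δ_v` by Ogg–Saito
[Silverman1994, IV Thm 11.1]; the bound is recorded here, like its siblings
`WeierstrassCurve.conductorExponent_le_five_of_natGenerator_eq_three` and
`WeierstrassCurve.conductorExponent_le_two_of_five_le_natGenerator` of `Conductor.lean`, as a
named fact, because the tree does not yet compute `f_v` at `v = 3` for the additive Kodaira types.

## References

* [Silverman1994] J. H. Silverman, *Advanced Topics in the Arithmetic of Elliptic Curves*, GTM 151,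
  Springer 1994: IV §10 (the conductor; Thm 10.2), IV §11 (Ogg's formula; the case `p = 3` via
  `L = K(E[2])`, PDF pp. 366–371), Exercise 4.41. Held: `book:silverman1994-advanced-topics-arithmetic-elliptic-curves`.
* J.-P. Serre, J. Tate, *Good reduction of abelian varieties*, Ann. of Math. 88 (1968), §3
  (the Swan conductor is read off `A[ℓ]`, any prime `ℓ ≠ p`).
* A. P. Ogg, *Elliptic curves and wild ramification*, Amer. J. Math. 89 (1967) 1–21.
-/

namespace Literature.NumberTheory.EllipticCurves

open WeierstrassCurve IsDedekindDomain Rat.HeightOneSpectrum Greenberg1999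

/-- **A rational point of order `2` forces `f₃ ≤ 2`.** If `E/ℚ` is an elliptic curve with a
rational point `(x, y)` of order `2` (`2y + a₁x + a₃ = 0`), then at the place `v = 3` the exponent
of the conductor satisfies `f₃(E) ≤ 2`, i.e. the wild part `δ₃` vanishes: the `2`-division field
`L = ℚ₃(E[2])` has degree `≤ 2` over `ℚ₃`, so it is tamely ramified and
`δ(E/ℚ₃) = Σ_{i≥1} g_i(L/ℚ₃)/g_0(L/ℚ₃) · dim_{𝔽₂}(E[2]/E[2]^{G_i}) = 0`, whence
`f₃ = ε₃ + δ₃ = ε₃ ∈ {0, 1, 2}`. Named fact (the tree's `conductorExponent` is Ogg's formula and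
the additive Kodaira types at `3` are not yet computed in the tree).
[cite: Silverman1994, IV §10 Thm 10.2 (f = ε + δ, ε ≤ 2; δ defined via L = K(E[ℓ]), ℓ ≠ p) and IV §11, proof of Thm 11.1 for p = 3 (δ(E/K) computed from L = K(E[2]); "L/K is not wildly ramified, so δ(E/K) = 0")] -/
def Silverman1994_conductorExponent_three_le_two_of_rationalTwoTorsion : Prop :=
  ∀ (W : WeierstrassCurve ℚ) [W.IsElliptic] (x : ℚ), HasRationalTwoTorsionX W x →
    ∀ v : HeightOneSpectrum ℤ, natGenerator v = 3 → W.conductorExponent v ≤ 2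

/-- Corollary (the global form consumed by the Birch–Swinnerton-Dyer line `star`,
hypothesis `hOgg3` of `starAdmissibleHabitat_of_facts`): a rational point of order `2` forces
`ord₃(N_E) ≤ 2`. [cite: Silverman1994, IV §10 Thm 10.2 and IV §11 (p = 3); AEC C.16 (N_E = ∏ p^{f_p})] -/
theorem Silverman1994_conductorExponent_three_le_two_of_rationalTwoTorsion.factorization_three_le_two
    (h : Silverman1994_conductorExponent_three_le_two_of_rationalTwoTorsion) :
    ∀ (V : WeierstrassCurve ℚ) [V.IsElliptic] (z : ℚ), HasRationalTwoTorsionX V z →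
      (V.conductorNorm ℤ).factorization 3 ≤ 2 := by
  intro V _ z hz
  have hf := factorization_conductorNorm_primesEquiv_symm V ⟨3, Nat.prime_three⟩
  rw [show ((⟨3, Nat.prime_three⟩ : Nat.Primes) : ℕ) = 3 from rfl] at hf
  rw [hf]
  exact h V z hz _
    (Literature.NumberTheory.EllipticCurves.Rat.natGenerator_primesEquiv_symm ⟨3, Nat.prime_three⟩)

/-- The semistable case is unconditional: if `E` has multiplicative reduction at `v` then
`f_v = 1 ≤ 2` (from the named fact `conductorExponent_eq_one_iff`, here the tree theorem
`conductorExponent_eq_one_iff_holds`). [cite: Silverman1994, IV.10.2(b)] -/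
theorem conductorExponent_le_two_of_hasMultiplicativeReductionAt (W : WeierstrassCurve ℚ)
    [W.IsElliptic] (v : HeightOneSpectrum ℤ) (h : W.HasMultiplicativeReductionAt v) :
    W.conductorExponent v ≤ 2 := by
  have h1 : W.conductorExponent v = 1 :=
    (conductorExponent_eq_one_iff_holds v W).mpr h
  omega

end Literature.NumberTheory.EllipticCurves
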